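import Summits.ValiantsHypothesis.ValiantsHypothesis.Theorems.LacunarySymmetroidMatrixDescartesCensusChamberSignCell
import Summits.ValiantsHypothesis.ValiantsHypothesis.Theorems.LacunarySymmetroidMatrixDescartesCensusLorentzRows

/-!
# `MatrixDescartes` census — CHAMBER-UNIFORM L-TRI KILL: the layer-2 sign rule as one polynomial certificate, and the
door-A row on every chamber that is sign-dead in both orientations

HONEST FRAMING.  Object-search cell `pub-symmetroid`, door-A target `DoorA26 := PosRootLawAt 2 6 19`
(stmt-ValiantsHypothesis-19979; OPEN, typed, never asserted), crux `Theses.LacunarySymmetroid.MatrixDescartes`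
(stmt-ValiantsHypothesis-18050).  At SIGN level the `V = 20` cells of the 2 608 pair-sum chambers of `(2,6)` (theory g6
CHAMBERS-2-6.md §3, §6) die by parity (C22, odd definite triangle: 2 278 cells; kernel schema
`Census.no_twenty_on_chamber_cell`, complete chamber rows for the 126 parity²-dead chambers in
`…CensusChamberSignClass{,A,B,C,D}.lean`) or by theory-2's layer-2 rules L-pair / L-tri (LAYER2-LEMMAS-t2.md, N31:
exactly 100 further cells, one in each of 100 chambers = 50 mirror pairs whose other cell is parity-dead).  Re-deriving
the rule engine on the chamber table shows that all 100 layer-2 kills are instances of ONE pattern, typed here as a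
kernel theorem with a purely polynomial proof:

* `ltri_normalized_false` / `ltri_antipodal_false` — **L-TRI KILL**: two definite letters `L, L'` cannot see three
  letters `W₁ W₂ W₃` in OPPOSITE cells (`β(L,L')β(L,Wₓ)β(L',Wₓ) < 0`) while the triangles `(L,Wₓ,W_y)` are even
  (`β(L,Wₓ)β(L,W_y)β(Wₓ,W_y) > 0`); `β(S,T) = S₀₀T₁₁ + S₁₁T₀₀ − 2S₀₁T₀₁` is twice the Lorentz pairing of
  `Sym₂(ℝ) ≅ ℝ^{1,2}`.  Geometrically (Klein disc): the polars of the `Wₓ` would be three lines each separating `L` from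
  `L'` and pairwise meeting at acute wedges — a hyperbolic triangle with two obtuse angles (theory-2's L-pair (b) +
  L-tri (i)(ii)).  The proof here is algebraic: project `β`-orthogonally to `L` (`E(X,Y) = β(L,X)β(L,Y) − β(L,L)β(X,Y)`),
  bound the three projected Gram minors by reverse Cauchy–Schwarz (`Census.four_det_mul_det_le_polarDet_sq`) and the
  sign hypotheses (`projGram_minor_neg`), and identify them with `2β(L,L)·Dₓ·D_y` by the two-dimensional Lagrange
  identity (`polar_lagrange_identity`, `ring`): three real numbers with pairwise negative products;
* `no_twenty_on_chamber_cell_ltri` — the ONE-ORIENTATION CHAMBER-UNIFORM form (positions in the chamber order `σ` as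
  decidable data, symbolic exponents `d`, same bookkeeping as `Census.no_twenty_on_chamber_cell`);
* `posRootLawOn_of_chamber_parity_ltri` — parity certificate for one orientation + L-tri certificate for the other ⇒
  `PosRootLawOn 2 6 19 d` on the WHOLE chamber (via `Census.posRootLawOn_of_chamber_cell`);
* the instances `doorA26_on_chamber<cid>` live in the companion files `…CensusChamberLtri{A,B,C,D}.lean` (100 chambers =
  50 mirror pairs), after which every chamber that is dead at sign level in both orientations (226 = 126 + 100 of
  2 608) has its complete door-A row in the kernel, uniformly in the exponents.

This is the SIGN layer only: nothing here touches the 2 382 chambers with a sign-realised or sign-open `V = 20` cell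
(magnitude arguments: `…CensusChamber<cid>.lean`, NFLOW), `DoorA26` as a whole (OPEN), the crux, or `VP ≠ VNP`.

[folklore] Elementary algebra of `2 × 2` symmetric matrices and Descartes' rule; the rule is theory-2 g3's (N31), the
certificate shape is this file's.
-/

-- `Summit.ValiantsHypothesis.ValiantsHypothesis.…` repeats a component by the D-0017 layout
-- (single-conjunct summit), which the `dupNamespace` linter flags; the name is mandated.
set_option linter.dupNamespace false

namespace Summit.ValiantsHypothesis.ValiantsHypothesis.Theorems.LacunarySymmetroidMatrixDescartes.Census

open Polynomial Finset
open scoped BigOperators Polynomial Matrix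

/-! ## The L-tri kill as a polynomial certificate -/

/-- **Lagrange identity for the projection along a letter.**  Write `β(S,T) = S₀₀T₁₁ + S₁₁T₀₀ − 2 S₀₁T₀₁` (twice the
polarised determinant, the Lorentz pairing of `Sym₂(ℝ) ≅ ℝ^{1,2}`) and, for a fixed letter `P`,
`E(X,Y) := β(P,X)β(P,Y) − β(P,P)β(X,Y)` (minus `β(P,P)` times the pairing of the `β`-orthogonal projections of
`X, Y` to `P^⊥`; for timelike `P` a positive-semidefinite form of rank `2`).  Then for all letters `Q, X, Y`:
`E(Q,Q)E(X,Y) − E(Q,X)E(Q,Y) = 2 β(P,P) · det[P;Q;X] · det[P;Q;Y]` (the `3 × 3` determinants of entry vectors) —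
the two-dimensional Lagrange identity `|u|²⟨x,y⟩ − ⟨u,x⟩⟨u,y⟩ = (u ∧ x)(u ∧ y)` on `P^⊥`. [folklore] -/
theorem polar_lagrange_identity (p₀ p₁ p₂ q₀ q₁ q₂ x₀ x₁ x₂ y₀ y₁ y₂ : ℝ) :
    ((p₀ * q₂ + p₂ * q₀ - 2 * (p₁ * q₁)) * (p₀ * q₂ + p₂ * q₀ - 2 * (p₁ * q₁))
        - (p₀ * p₂ + p₂ * p₀ - 2 * (p₁ * p₁)) * (q₀ * q₂ + q₂ * q₀ - 2 * (q₁ * q₁)))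
      * ((p₀ * x₂ + p₂ * x₀ - 2 * (p₁ * x₁)) * (p₀ * y₂ + p₂ * y₀ - 2 * (p₁ * y₁))
        - (p₀ * p₂ + p₂ * p₀ - 2 * (p₁ * p₁)) * (x₀ * y₂ + x₂ * y₀ - 2 * (x₁ * y₁)))
    - ((p₀ * q₂ + p₂ * q₀ - 2 * (p₁ * q₁)) * (p₀ * x₂ + p₂ * x₀ - 2 * (p₁ * x₁))
        - (p₀ * p₂ + p₂ * p₀ - 2 * (p₁ * p₁)) * (q₀ * x₂ + q₂ * x₀ - 2 * (q₁ * x₁)))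
      * ((p₀ * q₂ + p₂ * q₀ - 2 * (p₁ * q₁)) * (p₀ * y₂ + p₂ * y₀ - 2 * (p₁ * y₁))
        - (p₀ * p₂ + p₂ * p₀ - 2 * (p₁ * p₁)) * (q₀ * y₂ + q₂ * y₀ - 2 * (q₁ * y₁)))
    = 2 * (p₀ * p₂ + p₂ * p₀ - 2 * (p₁ * p₁))
      * (p₀ * (q₁ * x₂ - q₂ * x₁) - p₁ * (q₀ * x₂ - q₂ * x₀) + p₂ * (q₀ * x₁ - q₁ * x₀))
      * (p₀ * (q₁ * y₂ - q₂ * y₁) - p₁ * (q₀ * y₂ - q₂ * y₀) + p₂ * (q₀ * y₁ - q₁ * y₀)) := by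
  ring

/-- Arithmetic core of the L-tri kill: with `s, c > 0`, `0 ≤ m ≤ s²`, `tₓ, t_y > 0`, `bₓ, b_y < 0 < b`, the «projected
Gram minor» `m (tₓ t_y − c b) − (s tₓ − c bₓ)(s t_y − c b_y)` is negative. [folklore] -/
theorem projGram_minor_neg {s c m tx ty bx by' bxy : ℝ} (hs : 0 < s) (hc : 0 < c) (hm0 : 0 ≤ m)
    (hm : m ≤ s ^ 2) (htx : 0 < tx) (hty : 0 < ty) (hbx : bx < 0) (hby : by' < 0) (hbxy : 0 < bxy) :
    m * (tx * ty - c * bxy) - (s * tx - c * bx) * (s * ty - c * by') < 0 := by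
  have hgx : s * tx < s * tx - c * bx := by nlinarith [mul_pos hc (neg_pos.mpr hbx)]
  have hgy : s * ty < s * ty - c * by' := by nlinarith [mul_pos hc (neg_pos.mpr hby)]
  have hgx0 : 0 < s * tx := mul_pos hs htx
  have hgy0 : 0 < s * ty := mul_pos hs hty
  have hgg : s ^ 2 * (tx * ty) < (s * tx - c * bx) * (s * ty - c * by') := by
    have := mul_lt_mul'' hgx hgy hgx0.le hgy0.le
    nlinarith [this]
  rcases le_or_gt 0 (tx * ty - c * bxy) with hn | hn
  · -- non-negative minor entry: m n ≤ s² n ≤ s² tₓt_y < gₓ g_y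
    have h1 : m * (tx * ty - c * bxy) ≤ s ^ 2 * (tx * ty - c * bxy) :=
      mul_le_mul_of_nonneg_right hm hn
    have h2 : s ^ 2 * (tx * ty - c * bxy) ≤ s ^ 2 * (tx * ty) := by
      nlinarith [mul_pos hc hbxy, sq_nonneg s]
    linarith
  · have h1 : m * (tx * ty - c * bxy) ≤ 0 := mul_nonpos_of_nonneg_of_nonpos hm0 hn.le
    nlinarith [hgg, sq_nonneg s, mul_pos hgx0 hgy0]

/-- Three real numbers cannot have pairwise negative products. [folklore] -/
theorem false_of_pairwise_mul_neg {x y z : ℝ} (h₁ : x * y < 0) (h₂ : x * z < 0) (h₃ : y * z < 0) : False := by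
  have h := mul_pos_of_neg_of_neg h₁ h₂
  rw [show x * y * (x * z) = x ^ 2 * (y * z) by ring] at h
  linarith [mul_nonpos_of_nonneg_of_nonpos (sq_nonneg x) h₃.le]

/-- **L-TRI KILL, normalised form** (theory-2 LAYER2-LEMMAS §2–§3 combined, one polynomial certificate).  There are no
real symmetric `2 × 2` letters `P, P'` with `det P, det P' > 0`, `β(P,P') > 0`, and three letters `W₁ W₂ W₃` with
`β(P,Wₓ) > 0`, `β(P',Wₓ) < 0` (the two definite letters see the three in OPPOSITE cells) and `β(Wₓ,W_y) > 0` pairwise.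
Geometry: in the Klein disc the polars of the `Wₓ` would be three lines each separating `P` from `P'`, pairwise crossing
at acute wedges — two obtuse angles in a hyperbolic triangle.  Proof: with `E` as in `polar_lagrange_identity`,
`E(P',Wₓ) > β(P,P')β(P,Wₓ) > 0`, `E(Wₓ,W_y) < β(P,Wₓ)β(P,W_y)`, `0 ≤ E(P',P') ≤ β(P,P')²` (reverse Cauchy–Schwarz
`Census.four_det_mul_det_le_polarDet_sq`), so every projected Gram minor `E(P',P')E(Wₓ,W_y) − E(P',Wₓ)E(P',W_y)` is
negative (`projGram_minor_neg`); by the identity it equals `2β(P,P)·Dₓ·D_y`, so the three `3 × 3` determinants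
`Dₓ = det[P;P';Wₓ]` have pairwise negative products — impossible. [folklore] -/
theorem ltri_normalized_false (p₀ p₁ p₂ q₀ q₁ q₂ a₁ b₁ c₁ a₂ b₂ c₂ a₃ b₃ c₃ : ℝ)
    (hP : 0 < p₀ * p₂ - p₁ ^ 2) (hP' : 0 < q₀ * q₂ - q₁ ^ 2) (hs : 0 < p₀ * q₂ + p₂ * q₀ - 2 * (p₁ * q₁))
    (ht₁ : 0 < p₀ * c₁ + p₂ * a₁ - 2 * (p₁ * b₁)) (ht₂ : 0 < p₀ * c₂ + p₂ * a₂ - 2 * (p₁ * b₂))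
    (ht₃ : 0 < p₀ * c₃ + p₂ * a₃ - 2 * (p₁ * b₃))
    (hg₁ : q₀ * c₁ + q₂ * a₁ - 2 * (q₁ * b₁) < 0) (hg₂ : q₀ * c₂ + q₂ * a₂ - 2 * (q₁ * b₂) < 0)
    (hg₃ : q₀ * c₃ + q₂ * a₃ - 2 * (q₁ * b₃) < 0)
    (hn₁₂ : 0 < a₁ * c₂ + c₁ * a₂ - 2 * (b₁ * b₂)) (hn₁₃ : 0 < a₁ * c₃ + c₁ * a₃ - 2 * (b₁ * b₃))
    (hn₂₃ : 0 < a₂ * c₃ + c₂ * a₃ - 2 * (b₂ * b₃)) : False := by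
  -- abbreviations
  set s := p₀ * q₂ + p₂ * q₀ - 2 * (p₁ * q₁) with hs_def
  set c := p₀ * p₂ + p₂ * p₀ - 2 * (p₁ * p₁) with hc_def
  set t₁ := p₀ * c₁ + p₂ * a₁ - 2 * (p₁ * b₁) with ht₁_def
  set t₂ := p₀ * c₂ + p₂ * a₂ - 2 * (p₁ * b₂) with ht₂_def
  set t₃ := p₀ * c₃ + p₂ * a₃ - 2 * (p₁ * b₃) with ht₃_def
  set m := s * s - c * (q₀ * q₂ + q₂ * q₀ - 2 * (q₁ * q₁)) with hm_def
  have hc : 0 < c := by rw [hc_def]; nlinarith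
  have hm0 : 0 ≤ m := by
    have h := four_det_mul_det_le_polarDet_sq p₀ p₁ p₂ q₀ q₁ q₂ hP
    rw [hm_def, hc_def]; nlinarith [h]
  have hm : m ≤ s ^ 2 := by
    rw [hm_def, hc_def]; nlinarith [mul_pos hP hP']
  -- the three determinants
  set D₁ := p₀ * (q₁ * c₁ - q₂ * b₁) - p₁ * (q₀ * c₁ - q₂ * a₁) + p₂ * (q₀ * b₁ - q₁ * a₁) with hD₁
  set D₂ := p₀ * (q₁ * c₂ - q₂ * b₂) - p₁ * (q₀ * c₂ - q₂ * a₂) + p₂ * (q₀ * b₂ - q₁ * a₂) with hD₂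
  set D₃ := p₀ * (q₁ * c₃ - q₂ * b₃) - p₁ * (q₀ * c₃ - q₂ * a₃) + p₂ * (q₀ * b₃ - q₁ * a₃) with hD₃
  -- the three projected Gram minors are negative
  have M₁₂ := projGram_minor_neg (bxy := a₁ * c₂ + c₁ * a₂ - 2 * (b₁ * b₂)) hs hc hm0 hm ht₁ ht₂ hg₁ hg₂ hn₁₂
  have M₁₃ := projGram_minor_neg (bxy := a₁ * c₃ + c₁ * a₃ - 2 * (b₁ * b₃)) hs hc hm0 hm ht₁ ht₃ hg₁ hg₃ hn₁₃
  have M₂₃ := projGram_minor_neg (bxy := a₂ * c₃ + c₂ * a₃ - 2 * (b₂ * b₃)) hs hc hm0 hm ht₂ ht₃ hg₂ hg₃ hn₂₃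
  -- and equal to 2c·DₓD_y
  have I₁₂ := polar_lagrange_identity p₀ p₁ p₂ q₀ q₁ q₂ a₁ b₁ c₁ a₂ b₂ c₂
  have I₁₃ := polar_lagrange_identity p₀ p₁ p₂ q₀ q₁ q₂ a₁ b₁ c₁ a₃ b₃ c₃
  have I₂₃ := polar_lagrange_identity p₀ p₁ p₂ q₀ q₁ q₂ a₂ b₂ c₂ a₃ b₃ c₃
  simp only [← hs_def, ← hc_def, ← ht₁_def, ← ht₂_def, ← ht₃_def, ← hD₁, ← hD₂, ← hD₃] at I₁₂ I₁₃ I₂₃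
  have e₁₂ : m * (t₁ * t₂ - c * (a₁ * c₂ + c₁ * a₂ - 2 * (b₁ * b₂)))
      - (s * t₁ - c * (q₀ * c₁ + q₂ * a₁ - 2 * (q₁ * b₁))) * (s * t₂ - c * (q₀ * c₂ + q₂ * a₂ - 2 * (q₁ * b₂)))
      = 2 * c * D₁ * D₂ := by rw [hm_def]; linear_combination I₁₂
  have e₁₃ : m * (t₁ * t₃ - c * (a₁ * c₃ + c₁ * a₃ - 2 * (b₁ * b₃)))
      - (s * t₁ - c * (q₀ * c₁ + q₂ * a₁ - 2 * (q₁ * b₁))) * (s * t₃ - c * (q₀ * c₃ + q₂ * a₃ - 2 * (q₁ * b₃)))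
      = 2 * c * D₁ * D₃ := by rw [hm_def]; linear_combination I₁₃
  have e₂₃ : m * (t₂ * t₃ - c * (a₂ * c₃ + c₂ * a₃ - 2 * (b₂ * b₃)))
      - (s * t₂ - c * (q₀ * c₂ + q₂ * a₂ - 2 * (q₁ * b₂))) * (s * t₃ - c * (q₀ * c₃ + q₂ * a₃ - 2 * (q₁ * b₃)))
      = 2 * c * D₂ * D₃ := by rw [hm_def]; linear_combination I₂₃
  rw [e₁₂] at M₁₂; rw [e₁₃] at M₁₃; rw [e₂₃] at M₂₃
  have h2c : 0 < 2 * c := by linarith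
  have n₁₂ : D₁ * D₂ < 0 := neg_of_mul_neg_right (by linarith [M₁₂] : 2 * c * (D₁ * D₂) < 0) h2c.le
  have n₁₃ : D₁ * D₃ < 0 := neg_of_mul_neg_right (by linarith [M₁₃] : 2 * c * (D₁ * D₃) < 0) h2c.le
  have n₂₃ : D₂ * D₃ < 0 := neg_of_mul_neg_right (by linarith [M₂₃] : 2 * c * (D₂ * D₃) < 0) h2c.le
  exact false_of_pairwise_mul_neg n₁₂ n₁₃ n₂₃

/-! ## The chamber-uniform schema -/

/-- **L-TRI KILL** (sign-pattern form).  Two DEFINITE letters `L, L'` (`det > 0`) and three letters `W₁ W₂ W₃` whose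
polarised determinants have the sign pattern «the triangles `(L,L',Wₓ)` are ODD (`β(L,L')β(L,Wₓ)β(L',Wₓ) < 0`: `L`
and `L'` see each `Wₓ` in opposite cells) and the triangles `(L,Wₓ,W_y)` are EVEN (`β(L,Wₓ)β(L,W_y)β(Wₓ,W_y) > 0`)»
do not exist.  Reduction to `ltri_normalized_false`: rescale `P' := β(L,L')·L'`, `W̃ₓ := β(L,Wₓ)·Wₓ`. [folklore] -/
theorem ltri_antipodal_false (a b c a' b' c' a₁ b₁ c₁ a₂ b₂ c₂ a₃ b₃ c₃ : ℝ)
    (hL : 0 < a * c - b ^ 2) (hL' : 0 < a' * c' - b' ^ 2)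
    (h₁ : (a * c' + c * a' - 2 * (b * b')) * (a * c₁ + c * a₁ - 2 * (b * b₁)) * (a' * c₁ + c' * a₁ - 2 * (b' * b₁)) < 0)
    (h₂ : (a * c' + c * a' - 2 * (b * b')) * (a * c₂ + c * a₂ - 2 * (b * b₂)) * (a' * c₂ + c' * a₂ - 2 * (b' * b₂)) < 0)
    (h₃ : (a * c' + c * a' - 2 * (b * b')) * (a * c₃ + c * a₃ - 2 * (b * b₃)) * (a' * c₃ + c' * a₃ - 2 * (b' * b₃)) < 0)
    (h₁₂ : 0 < (a * c₁ + c * a₁ - 2 * (b * b₁)) * (a * c₂ + c * a₂ - 2 * (b * b₂)) * (a₁ * c₂ + c₁ * a₂ - 2 * (b₁ * b₂)))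
    (h₁₃ : 0 < (a * c₁ + c * a₁ - 2 * (b * b₁)) * (a * c₃ + c * a₃ - 2 * (b * b₃)) * (a₁ * c₃ + c₁ * a₃ - 2 * (b₁ * b₃)))
    (h₂₃ : 0 < (a * c₂ + c * a₂ - 2 * (b * b₂)) * (a * c₃ + c * a₃ - 2 * (b * b₃))
      * (a₂ * c₃ + c₂ * a₃ - 2 * (b₂ * b₃))) : False := by
  set κ := a * c' + c * a' - 2 * (b * b') with hκ
  set β₁ := a * c₁ + c * a₁ - 2 * (b * b₁) with hβ₁
  set β₂ := a * c₂ + c * a₂ - 2 * (b * b₂) with hβ₂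
  set β₃ := a * c₃ + c * a₃ - 2 * (b * b₃) with hβ₃
  have hκ0 : κ ≠ 0 := by
    intro h0; rw [h0] at h₁; simp at h₁
  have hβ₁0 : β₁ ≠ 0 := by
    intro h0; rw [h0] at h₁; simp at h₁
  have hβ₂0 : β₂ ≠ 0 := by
    intro h0; rw [h0] at h₂; simp at h₂
  have hβ₃0 : β₃ ≠ 0 := by
    intro h0; rw [h0] at h₃; simp at h₃
  refine ltri_normalized_false a b c (κ * a') (κ * b') (κ * c') (β₁ * a₁) (β₁ * b₁) (β₁ * c₁)
    (β₂ * a₂) (β₂ * b₂) (β₂ * c₂) (β₃ * a₃) (β₃ * b₃) (β₃ * c₃) hL ?_ ?_ ?_ ?_ ?_ ?_ ?_ ?_ ?_ ?_ ?_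
  · have e : κ * a' * (κ * c') - (κ * b') ^ 2 = κ ^ 2 * (a' * c' - b' ^ 2) := by ring
    rw [e]; positivity
  · have e : a * (κ * c') + c * (κ * a') - 2 * (b * (κ * b')) = κ ^ 2 := by rw [hκ]; ring
    rw [e]; positivity
  · have e : a * (β₁ * c₁) + c * (β₁ * a₁) - 2 * (b * (β₁ * b₁)) = β₁ ^ 2 := by rw [hβ₁]; ring
    rw [e]; positivity
  · have e : a * (β₂ * c₂) + c * (β₂ * a₂) - 2 * (b * (β₂ * b₂)) = β₂ ^ 2 := by rw [hβ₂]; ring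
    rw [e]; positivity
  · have e : a * (β₃ * c₃) + c * (β₃ * a₃) - 2 * (b * (β₃ * b₃)) = β₃ ^ 2 := by rw [hβ₃]; ring
    rw [e]; positivity
  · have e : κ * a' * (β₁ * c₁) + κ * c' * (β₁ * a₁) - 2 * (κ * b' * (β₁ * b₁))
        = κ * β₁ * (a' * c₁ + c' * a₁ - 2 * (b' * b₁)) := by ring
    rw [e]; linarith [h₁]
  · have e : κ * a' * (β₂ * c₂) + κ * c' * (β₂ * a₂) - 2 * (κ * b' * (β₂ * b₂))
        = κ * β₂ * (a' * c₂ + c' * a₂ - 2 * (b' * b₂)) := by ring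
    rw [e]; linarith [h₂]
  · have e : κ * a' * (β₃ * c₃) + κ * c' * (β₃ * a₃) - 2 * (κ * b' * (β₃ * b₃))
        = κ * β₃ * (a' * c₃ + c' * a₃ - 2 * (b' * b₃)) := by ring
    rw [e]; linarith [h₃]
  · have e : β₁ * a₁ * (β₂ * c₂) + β₁ * c₁ * (β₂ * a₂) - 2 * (β₁ * b₁ * (β₂ * b₂))
        = β₁ * β₂ * (a₁ * c₂ + c₁ * a₂ - 2 * (b₁ * b₂)) := by ring
    rw [e]; linarith [h₁₂]
  · have e : β₁ * a₁ * (β₃ * c₃) + β₁ * c₁ * (β₃ * a₃) - 2 * (β₁ * b₁ * (β₃ * b₃))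
        = β₁ * β₃ * (a₁ * c₃ + c₁ * a₃ - 2 * (b₁ * b₃)) := by ring
    rw [e]; linarith [h₁₃]
  · have e : β₂ * a₂ * (β₃ * c₃) + β₂ * c₂ * (β₃ * a₃) - 2 * (β₂ * b₂ * (β₃ * b₃))
        = β₂ * β₃ * (a₂ * c₃ + c₂ * a₃ - 2 * (b₂ * b₃)) := by ring
    rw [e]; linarith [h₂₃]

/-- Product of three twisted-positive reals whose twist exponents have EVEN sum is positive. [folklore] -/
theorem prod_pos_of_pos_twists_even {β₁ β₂ β₃ : ℝ} {r₁ r₂ r₃ : ℕ} (h1 : 0 < (-1 : ℝ) ^ r₁ * β₁)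
    (h2 : 0 < (-1 : ℝ) ^ r₂ * β₂) (h3 : 0 < (-1 : ℝ) ^ r₃ * β₃) (hev : Even (r₁ + r₂ + r₃)) :
    0 < β₁ * β₂ * β₃ := by
  have key := mul_pos (mul_pos h1 h2) h3
  have : (-1 : ℝ) ^ r₁ * β₁ * ((-1 : ℝ) ^ r₂ * β₂) * ((-1 : ℝ) ^ r₃ * β₃)
      = (-1 : ℝ) ^ (r₁ + r₂ + r₃) * (β₁ * β₂ * β₃) := by rw [pow_add, pow_add]; ring
  rw [this, hev.neg_one_pow] at key
  linarith

/-- **ONE-ORIENTATION CHAMBER-UNIFORM L-TRI KILL.**  `σ` lists the 21 pairs in the order of their sums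
(`σ 0 = (i₀,i₀)` lowest); `η` encodes the orientation «`(−1)^η det S_{i₀} > 0`» (`sign c_p = (−1)^{p+η}` for a twenty).
Data: letters `l, l'` with diagonal positions `a, a'` of parity `η` (definite), letters `j k m`, and the positions `h` of
`{l,l'}`, `eₓ` of `{l,x}`, `fₓ` of `{l',x}`, `t` of the pairs inside `{j,k,m}`, with `h + eₓ + fₓ + η` ODD (odd triangles
`(l,l',x)`) and `e + e' + t + η` EVEN (even triangles `(l,x,y)`) — all decidable.  Then on EVERY exponent vector `d` of
the chamber no real symmetric `2 × 2` pencil of that orientation has `20 = D(2,6)` distinct positive det-roots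
(`ltri_antipodal_false` on the forced signs; bookkeeping as in `Census.no_twenty_on_chamber_cell`). [folklore] -/
theorem no_twenty_on_chamber_cell_ltri (σ : Fin 21 → Fin 6 × Fin 6) (η : ℕ) (i₀ l l' j k m : Fin 6)
    (a a' h e₁ e₂ e₃ f₁ f₂ f₃ t₁ t₂ t₃ : Fin 21)
    (hcert : (∀ p : Fin 6 × Fin 6, ∃ t : Fin 21, σ t = p ∨ σ t = p.swap) ∧ σ 0 = (i₀, i₀) ∧
      (l ≠ l' ∧ l ≠ j ∧ l ≠ k ∧ l ≠ m ∧ l' ≠ j ∧ l' ≠ k ∧ l' ≠ m ∧ j ≠ k ∧ j ≠ m ∧ k ≠ m) ∧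
      (σ a = (l, l) ∧ σ a' = (l', l')) ∧
      ((σ h = (l, l') ∨ σ h = (l', l)) ∧ (σ e₁ = (l, j) ∨ σ e₁ = (j, l)) ∧ (σ e₂ = (l, k) ∨ σ e₂ = (k, l)) ∧
        (σ e₃ = (l, m) ∨ σ e₃ = (m, l)) ∧ (σ f₁ = (l', j) ∨ σ f₁ = (j, l')) ∧ (σ f₂ = (l', k) ∨ σ f₂ = (k, l')) ∧
        (σ f₃ = (l', m) ∨ σ f₃ = (m, l')) ∧ (σ t₁ = (j, k) ∨ σ t₁ = (k, j)) ∧ (σ t₂ = (j, m) ∨ σ t₂ = (m, j)) ∧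
        (σ t₃ = (k, m) ∨ σ t₃ = (m, k))) ∧
      (Even ((a : ℕ) + η) ∧ Even ((a' : ℕ) + η)) ∧
      (Odd ((h : ℕ) + e₁ + f₁ + η) ∧ Odd ((h : ℕ) + e₂ + f₂ + η) ∧ Odd ((h : ℕ) + e₃ + f₃ + η)) ∧
      (Even ((e₁ : ℕ) + e₂ + t₁ + η) ∧ Even ((e₁ : ℕ) + e₃ + t₂ + η) ∧ Even ((e₂ : ℕ) + e₃ + t₃ + η)))
    (d : Fin 6 → ℕ) (hd : StrictMono ((fun p : Fin 6 × Fin 6 => d p.1 + d p.2) ∘ σ))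
    (S : Fin 6 → Matrix (Fin 2) (Fin 2) ℝ) (hS : ∀ l, (S l).IsSymm)
    (hZ : 20 ≤ ((∑ l, ((X : ℝ[X]) ^ d l) • (S l).map C).det.roots.toFinset.filter (fun t => 0 < t)).card)
    (hs : 0 < (-1 : ℝ) ^ η * (S i₀ 0 0 * S i₀ 1 1 - S i₀ 0 1 ^ 2)) : False := by
  obtain ⟨hcov, h0, ⟨hll', hlj, hlk, hlm, hl'j, hl'k, hl'm, hjk, hjm, hkm⟩, ⟨ha, ha'⟩,
    ⟨hh, he₁, he₂, he₃, hf₁, hf₂, hf₃, ht₁, ht₂, ht₃⟩, ⟨pa, pa'⟩, ⟨po₁, po₂, po₃⟩, ⟨pe₁, pe₂, pe₃⟩⟩ := hcert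
  set P := (∑ l, ((X : ℝ[X]) ^ d l) • (S l).map C).det with hP_def
  set W := (Finset.univ : Finset (Fin 6 × Fin 6)).image (fun p => d p.1 + d p.2) with hW_def
  have hN : W.card = 21 := card_pairSums_of_chamber σ hcov d hd
  have memW : ∀ u v : Fin 6, d u + d v ∈ W := fun u v =>
    Finset.mem_image.mpr ⟨(u, v), Finset.mem_univ _, rfl⟩
  have hP : P ≠ 0 := by
    intro hP0
    have : (P.roots.toFinset.filter (fun t => 0 < t)).card = 0 := by rw [hP0]; simp
    omega
  have hsupp : P.support = W := by
    have hsub : P.support ⊆ W := by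
      rw [hP_def, hW_def, ← sumset_two_eq_pairSums d]; exact support_det_pencil_subset_sumset d S
    refine Finset.eq_of_subset_of_card_le hsub ?_
    have h := Literature.Computability.AlgebraicComplexity.card_roots_toFinset_filter_pos_lt_card_support hP
    omega
  have hZ' : P.support.card ≤ (P.roots.toFinset.filter (fun t => 0 < t)).card + 1 := by
    rw [hsupp]; omega
  -- F1 in rank form
  have F1 : ∀ x y : ℕ, x ∈ W → y ∈ W →
      0 < (-1 : ℝ) ^ ((W.filter (· < x)).card + (W.filter (· < y)).card) * (P.coeff x * P.coeff y) := by
    intro x y hx hy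
    have := pow_rank_mul_coeff_mul_coeff_pos_of_sharp P hZ' (by rw [hsupp]; exact hx) (by rw [hsupp]; exact hy)
    rwa [hsupp] at this
  -- chamber bookkeeping: listed sums, uniqueness, ranks
  have hsum : ∀ {t : Fin 21} {u v : Fin 6}, σ t = (u, v) → d u + d v = d (σ t).1 + d (σ t).2 := by
    intro t u v ht; rw [ht]
  have udiag : ∀ {t : Fin 21} {u : Fin 6}, σ t = (u, u) →
      ∀ p : Fin 6 × Fin 6, d p.1 + d p.2 = d u + d u → p = (u, u) := by
    intro t u ht p hp
    rw [hsum ht] at hp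
    rcases pair_eq_of_chamber σ hcov d hd t p hp with h | h
    · rw [h, ht]
    · rw [h, ht]; rfl
  have upair : ∀ {t : Fin 21} {u v : Fin 6}, σ t = (u, v) →
      ∀ p : Fin 6 × Fin 6, d p.1 + d p.2 = d u + d v → p = (u, v) ∨ p = (v, u) := by
    intro t u v ht p hp
    rw [hsum ht] at hp
    rcases pair_eq_of_chamber σ hcov d hd t p hp with h | h
    · left; rw [h, ht]
    · right; rw [h, ht]; rfl
  have rk : ∀ {t : Fin 21} {u v : Fin 6}, σ t = (u, v) → (W.filter (· < d u + d v)).card = t := by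
    intro t u v ht
    rw [hsum ht]
    exact card_filter_lt_of_chamber σ hcov d hd t
  -- the dictionary (F0) in entry coordinates
  have hsym : ∀ l, S l 1 0 = S l 0 1 := fun l => by
    have h := congrFun (congrFun (hS l) 1) 0
    simp only [Matrix.transpose_apply] at h
    exact h.symm
  have hdiag : ∀ {t : Fin 21} {u : Fin 6}, σ t = (u, u) → P.coeff (d u + d u) = S u 0 0 * S u 1 1 - S u 0 1 ^ 2 := by
    intro t u ht; rw [hP_def, coeff_det_pencil_two_diag d S u (udiag ht), hsym, sq]
  have hpair : ∀ {t : Fin 21} {u v : Fin 6}, σ t = (u, v) → u ≠ v →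
      P.coeff (d u + d v) = S u 0 0 * S v 1 1 + S u 1 1 * S v 0 0 - 2 * (S u 0 1 * S v 0 1) := by
    intro t u v ht huv; rw [hP_def, coeff_det_pencil_two_pair d S huv (upair ht), hsym, hsym]; ring
  -- every twisted coefficient has the sign of the orientation
  have tw : ∀ x : ℕ, x ∈ W → 0 < (-1 : ℝ) ^ ((W.filter (· < x)).card + η) * P.coeff x := by
    intro x hx
    have h1 := F1 (d i₀ + d i₀) x (memW i₀ i₀) hx
    rw [rk h0, hdiag h0] at h1
    simp only [Fin.val_zero, zero_add] at h1
    have h2 : 0 < ((-1 : ℝ) ^ (W.filter (· < x)).card * ((S i₀ 0 0 * S i₀ 1 1 - S i₀ 0 1 ^ 2) * P.coeff x)) *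
        ((-1 : ℝ) ^ η * (S i₀ 0 0 * S i₀ 1 1 - S i₀ 0 1 ^ 2)) := mul_pos h1 hs
    have h3 : ((-1 : ℝ) ^ (W.filter (· < x)).card * ((S i₀ 0 0 * S i₀ 1 1 - S i₀ 0 1 ^ 2) * P.coeff x)) *
        ((-1 : ℝ) ^ η * (S i₀ 0 0 * S i₀ 1 1 - S i₀ 0 1 ^ 2))
        = ((-1 : ℝ) ^ ((W.filter (· < x)).card + η) * P.coeff x) * (S i₀ 0 0 * S i₀ 1 1 - S i₀ 0 1 ^ 2) ^ 2 := by
      rw [pow_add]; ring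
    rw [h3] at h2
    exact pos_of_mul_pos_left h2 (sq_nonneg _)
  -- definite letters
  have hdet : ∀ {t : Fin 21} {u : Fin 6}, σ t = (u, u) → Even ((t : ℕ) + η) → 0 < S u 0 0 * S u 1 1 - S u 0 1 ^ 2 := by
    intro t u ht hev
    have := tw _ (memW u u)
    rw [rk ht, hev.neg_one_pow, hdiag ht] at this
    linarith
  -- mixed letters, twisted (literal orientation of the pair)
  have hmix : ∀ {t : Fin 21} {u v : Fin 6}, σ t = (u, v) → u ≠ v →
      0 < (-1 : ℝ) ^ ((t : ℕ) + η) * (S u 0 0 * S v 1 1 + S u 1 1 * S v 0 0 - 2 * (S u 0 1 * S v 0 1)) := by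
    intro t u v ht huv
    have := tw _ (memW u v)
    rwa [rk ht, hpair ht huv] at this
  -- mixed letters, twisted (either orientation of the pair)
  have hmix' : ∀ {t : Fin 21} {u v : Fin 6}, (σ t = (u, v) ∨ σ t = (v, u)) → u ≠ v →
      0 < (-1 : ℝ) ^ ((t : ℕ) + η) * (S u 0 0 * S v 1 1 + S u 1 1 * S v 0 0 - 2 * (S u 0 1 * S v 0 1)) := by
    intro t u v ht huv
    rcases ht with ht | ht
    · exact hmix ht huv
    · have h := hmix ht huv.symm
      have e : S v 0 0 * S u 1 1 + S v 1 1 * S u 0 0 - 2 * (S v 0 1 * S u 0 1)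
          = S u 0 0 * S v 1 1 + S u 1 1 * S v 0 0 - 2 * (S u 0 1 * S v 0 1) := by ring
      rwa [e] at h
  have hΔl := hdet ha pa
  have hΔl' := hdet ha' pa'
  have bh := hmix' hh hll'
  have b₁ := hmix' he₁ hlj
  have b₂ := hmix' he₂ hlk
  have b₃ := hmix' he₃ hlm
  have c₁ := hmix' hf₁ hl'j
  have c₂ := hmix' hf₂ hl'k
  have c₃ := hmix' hf₃ hl'm
  have g₁ := hmix' ht₁ hjk
  have g₂ := hmix' ht₂ hjm
  have g₃ := hmix' ht₃ hkm
  -- sign products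
  have twist3 : ∀ {x y z : ℕ}, ((x : ℕ) + η) + ((y : ℕ) + η) + ((z : ℕ) + η) = (x + y + z + η) + 2 * η := by
    intro x y z; ring
  have od : ∀ {x y z : ℕ}, Odd (x + y + z + η) → Odd ((x + η) + (y + η) + (z + η)) := by
    intro x y z ho; rw [twist3]; exact ho.add_even (even_two_mul η)
  have ev : ∀ {x y z : ℕ}, Even (x + y + z + η) → Even ((x + η) + (y + η) + (z + η)) := by
    intro x y z hev; rw [twist3]; exact hev.add (even_two_mul η)
  have o₁ := prod_neg_of_pos_twists_odd bh b₁ c₁ (od po₁)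
  have o₂ := prod_neg_of_pos_twists_odd bh b₂ c₂ (od po₂)
  have o₃ := prod_neg_of_pos_twists_odd bh b₃ c₃ (od po₃)
  have v₁ := prod_pos_of_pos_twists_even b₁ b₂ g₁ (ev pe₁)
  have v₂ := prod_pos_of_pos_twists_even b₁ b₃ g₂ (ev pe₂)
  have v₃ := prod_pos_of_pos_twists_even b₂ b₃ g₃ (ev pe₃)
  exact ltri_antipodal_false (S l 0 0) (S l 0 1) (S l 1 1) (S l' 0 0) (S l' 0 1) (S l' 1 1)
    (S j 0 0) (S j 0 1) (S j 1 1) (S k 0 0) (S k 0 1) (S k 1 1) (S m 0 0) (S m 0 1) (S m 1 1)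
    hΔl hΔl' o₁ o₂ o₃ v₁ v₂ v₃

/-- **COMPLETE CHAMBER ROW from one parity cell and one L-tri cell.**  A sign-class (odd definite triangle) certificate
for the orientation `η` and an L-tri certificate for the orientation `η + 1` give `ζ(2,6; d) ≤ 19` for EVERY exponent
vector `d` of the chamber of `σ` (via `posRootLawOn_of_chamber_cell`, whose degenerate case `det S_{i₀} = 0` is
Descartes). [folklore] -/
theorem posRootLawOn_of_chamber_parity_ltri (σ : Fin 21 → Fin 6 × Fin 6) (η : ℕ) (i₀ i j k : Fin 6)
    (a b c e f g : Fin 21) (l l' j' k' m' : Fin 6) (a₁ a₂ h e₁ e₂ e₃ f₁ f₂ f₃ t₁ t₂ t₃ : Fin 21)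
    (hcert : (∀ p : Fin 6 × Fin 6, ∃ t : Fin 21, σ t = p ∨ σ t = p.swap) ∧ σ 0 = (i₀, i₀) ∧
      (i ≠ j ∧ j ≠ k ∧ i ≠ k) ∧
      (σ a = (i, i) ∧ σ b = (j, j) ∧ σ c = (k, k) ∧ σ e = (i, j) ∧ σ f = (j, k) ∧ σ g = (i, k)) ∧
      (Even ((a : ℕ) + η) ∧ Even ((b : ℕ) + η) ∧ Even ((c : ℕ) + η) ∧ Odd ((e : ℕ) + f + g + η)))
    (hcert' : (∀ p : Fin 6 × Fin 6, ∃ t : Fin 21, σ t = p ∨ σ t = p.swap) ∧ σ 0 = (i₀, i₀) ∧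
      (l ≠ l' ∧ l ≠ j' ∧ l ≠ k' ∧ l ≠ m' ∧ l' ≠ j' ∧ l' ≠ k' ∧ l' ≠ m' ∧ j' ≠ k' ∧ j' ≠ m' ∧ k' ≠ m') ∧
      (σ a₁ = (l, l) ∧ σ a₂ = (l', l')) ∧
      ((σ h = (l, l') ∨ σ h = (l', l)) ∧ (σ e₁ = (l, j') ∨ σ e₁ = (j', l)) ∧ (σ e₂ = (l, k') ∨ σ e₂ = (k', l)) ∧
        (σ e₃ = (l, m') ∨ σ e₃ = (m', l)) ∧ (σ f₁ = (l', j') ∨ σ f₁ = (j', l')) ∧ (σ f₂ = (l', k') ∨ σ f₂ = (k', l')) ∧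
        (σ f₃ = (l', m') ∨ σ f₃ = (m', l')) ∧ (σ t₁ = (j', k') ∨ σ t₁ = (k', j')) ∧
        (σ t₂ = (j', m') ∨ σ t₂ = (m', j')) ∧ (σ t₃ = (k', m') ∨ σ t₃ = (m', k'))) ∧
      (Even ((a₁ : ℕ) + (η + 1)) ∧ Even ((a₂ : ℕ) + (η + 1))) ∧
      (Odd ((h : ℕ) + e₁ + f₁ + (η + 1)) ∧ Odd ((h : ℕ) + e₂ + f₂ + (η + 1)) ∧ Odd ((h : ℕ) + e₃ + f₃ + (η + 1))) ∧
      (Even ((e₁ : ℕ) + e₂ + t₁ + (η + 1)) ∧ Even ((e₁ : ℕ) + e₃ + t₂ + (η + 1)) ∧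
        Even ((e₂ : ℕ) + e₃ + t₃ + (η + 1))))
    (d : Fin 6 → ℕ) (hd : StrictMono ((fun p : Fin 6 × Fin 6 => d p.1 + d p.2) ∘ σ)) : PosRootLawOn 2 6 19 d :=
  posRootLawOn_of_chamber_cell σ η i₀ i j k a b c e f g hcert d hd
    (fun S hS hZ hs => no_twenty_on_chamber_cell_ltri σ (η + 1) i₀ l l' j' k' m' a₁ a₂ h e₁ e₂ e₃ f₁ f₂ f₃ t₁ t₂ t₃
      hcert' d hd S hS hZ hs)

end Summit.ValiantsHypothesis.ValiantsHypothesis.Theorems.LacunarySymmetroidMatrixDescartes.Census
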